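import Mathlib.NumberTheory.Cyclotomic.Basic
import Literature.NumberTheory.EllipticCurves.IwasawaSelmerEigen
import Literature.NumberTheory.EllipticCurves.SelmerPInftyRestriction
import Literature.NumberTheory.EllipticCurves.Wuthrich2014.ReducibleDivisibilityCyclotomicThree
import Literature.NumberTheory.EllipticCurves.PAdicLFunctionMinusMult
import HarnessLib

/-!
# Kato's divisibility at `p = 3` for curves SEMISTABLE at `3` with SURJECTIVE `ρ_{E,3^∞}` — the
# `ω`-COMPONENT: `char_{Λ(Γ)}(e_ω X(E/ℚ(ζ_{3^∞}))) ∋ u · L₃(E, ω, T)` (Kato 2004 Thm. 17.4 (3) at a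
# good ordinary `3`; Wuthrich 2014 Thm. 3 / Cor. 19 "proven by Kato" at a multiplicative `3`; named fact,
# the componentwise form of the accepted product readings)

Sources, as PUBLISHED. (a) K. Kato, *`p`-adic Hodge theory and values of zeta functions of modular
forms*, Astérisque 295 (2004) [Kato2004Asterisque], **Theorem 17.4** (p. 273): "Assume `f` has good
ordinary reduction at `λ`. Let `T` be a `Gal(ℚ̄/ℚ)`-stable `O_λ`-lattice of `V_{F_λ}(f)`. (1) `X(T)` is
a torsion `Λ`-module. […] (3) Let `α, ω, γ` be as in (2), and assume that both `ω` and `γ` are good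
[…]. Assume further `p ≠ 2` and that the condition 12.5.2 in 12.5 (4) is satisfied. Then
`L_{p-adic,α,ω,γ}(f)` belongs to `Λ` and `length_{Λ_𝔭}(X(T)_𝔭) ≤ ord_𝔭(L_{p-adic,α,ω,γ}(f))` for any
prime ideal `𝔭` of `Λ` of height one", with §17.3 (p. 273: `X(T)` the dual of
`Sel_∞(T) = lim_n Sel(ℚ(ζ_{p^n}), T(r))(−r)`, "We regard `X(T)` as a module over `Λ = O_λ⟦G_∞⟧`"),
§12.1 (p. 219: `G_∞ = Gal(ℚ(ζ_{p^∞})/ℚ)`), (12.5.2) (p. 222: "the image of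
`Gal(ℚ̄/ℚ(ζ_{p^∞})) → GL_{O_λ}(T)` contains `SL₂(ℤ_p)`"), §17.5 (p. 274: good `ω`, `γ`), Thm. 16.2
(p. 269). (b) C. Wuthrich, Doc. Math. 19 (2014) 381–402 [Wuthrich2014], §1 Thm. 3 (p. 383): "We
formulate it here for the full cyclotomic `ℤ_p^×`-extension. Theorem 3. Let `E` be an elliptic curve
and `p` an odd prime of semi-stable reduction. Assume that `E[p]` is reducible […]. Then the
characteristic series of the dual of the Selmer group over the cyclotomic extension [divides the ideal
generated by `L_p(E)`] […] In the case when `E` has split multiplicative reduction, one can strengthen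
this a bit, see theorem 16. **This theorem was proven by Kato in [Kato 2004] in the case that the
representation on the Tate module was surjective.**"; Cor. 19 (p. 398) and its proof (p. 399): "If
`E/ℚ` is a semi-stable elliptic curve and `p` an odd prime, then `char_Λ X(E)`, or `I char_Λ X(E)` in
the split multiplicative case, divides the ideal generated by `L_p(E)`. Proof. By a theorem of Serre
[…] the image of `ρ̄_p` is either the whole of `GL₂(𝔽_p)` or it is contained in a Borel subgroup. In
the latter case the representation `ρ̄_p` is reducible and in the first case the representation
`ρ_p : G_ℚ → Aut(T_p E)` is surjective by another result of Serre unless `p = 3`. Finally for `p = 3`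
we use the following lemma to exclude that `ρ_p` is not surjective." — the FIRST CASE of the printed
proof derives the conclusion from the surjectivity of `ρ_p` on `T_pE` alone, at every odd `p`
INCLUDING `p = 3`; §3 (p. 390): "we split `M` up into the eigenspaces `M = ⊕_{i=0}^{p−2} M_i` where
`Δ` acts on `M_i` […] by the `i`-th power of the Teichmüller character"; §5 (p. 397): `X(E)` = the
dual of `lim_n Sel(E/ℚ(ζ_{p^n}))`, "`Λ`-torsion … in general in our situation"; §4 (p. 396): `char_Λ`
= product over height-one primes; Cor. 18 (p. 398): `L_p(E) ∈ Λ` for semi-stable `p > 2`. Torsion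
over the abelian base `ℚ(ζ₃)` also: Greenberg, LNM 1716 Thm. 1.5 (PDF p. 61); eigenspace descent
display: LNM 1716 §5 p. 143.

ONE NAMED FACT (`def … : Prop`, nothing asserted, D-0014/D-0026): the big-image TWIN of
`thm16_minusEigenCharIdeal_dvd_cyclotomicThree` (same file family): Kato's divisibility over the full
`ℤ₃^×`-tower for a curve SEMISTABLE at `3` with `ρ_{E,3^∞}` onto, READ ON THE `ω`-EIGENCOMPONENT
ALONE — the reading that the accepted product siblings
`Kato2004.charIdeal_dvd_padicLFunction_cyclotomicThree_of_surjective` (p216633, good ordinary `3`;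
referee R105.2, flag `Kato-17.4-p3-branch-split`),
`Wuthrich2014.kato_charIdeal_dvd_nonsplitMultiplicative_cyclotomicThree_of_surjective` and its split
sibling (flags `Wu14-surj-attribution`, `Wu14-Thm16-p3-branch-split`) pass through BEFORE multiplying
the two components: "the printed inequality at every height-one prime says `char(e_±X) ∣ e_±L` in
`Λ(Γ)`, whence — characteristic ideals being multiplicative over `X = e₊X ⊕ e₋X` — …". Here we STOP
at `char_{Λ(Γ)}(e₋X) ∣ e₋L`, transcribed in the tree's SUBGROUP model of Selmer groups over `Γ_ℚ`
with the eigen-vocabulary of `IwasawaSelmerEigen` (`eigenSelmerGroupOver`, `EigenSelmerDualData`).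

## The reading (identical to the reducible twin; only the source sentences differ)

`Λ = ℤ₃⟦G_∞⟧ = Λ(Γ)e₊ ⊕ Λ(Γ)e₋` (`G_∞ = Δ × Γ`, `Δ = Gal(ℚ(ζ₃)/ℚ) = {1, c}`, `3 ∤ #Δ`); the
height-one primes of `Λ` are those of the two factors `Λ(Γ)` (a UFD), so Kato's
"`length_{Λ_𝔭}(X_𝔭) ≤ ord_𝔭(L)` for every height-one `𝔭`" (good ordinary) resp. Wuthrich's
"`char_Λ X(E)` [or `I·char_Λ X(E)`] divides `(L_p(E))`" (multiplicative, "proven by Kato" under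
surjectivity) SAYS `char_{Λ(Γ)}(e₊X) ∣ e₊L` and **`char_{Λ(Γ)}(e₋X) ∣ e₋L`**; in the split case
`e₋ ∈ I` (the augmentation kills `e₋ = (1 − [c])/2`), `e₋I = e₋Λ`, so NO extra factor on the odd
component. `e₋L ↔ L₃(E, ω, T)`, the ODD tame branch of the Néron-normalised MTT measure (Kato
Thm. 16.2 with `ω` Néron, `γ` good; MTT 1986 §I.13, minus modular symbols): two-term measure with the
unit root `α` at good ordinary `3` (tree `padicLFunctionMinusBranch f α 1`), one-term measure
(`ε(p) = 0`, §I.10) with `α = a₃ = ±1` at multiplicative `3` (tree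
`padicLFunctionMinusBranchMult f (±1) 1`). Field and module, exactly as in the reducible twin:
`ℚ(ζ_{3^∞}) = K·ℚ_∞`, `K = ℚ(ζ₃)`; `Gal(ℚ̄/ℚ(ζ_{3^∞})) = ker κ ⊓ galRange K =: H` (`κ` THE cyclotomic
`ℤ₃`-extension of `ℚ`, `κ.IsCyclotomic`), `H' := ker κ = Gal(ℚ̄/ℚ_∞)`, `Δ ≅ H'/H` acting by `g_*`,
`ω(g) = ±1` according as `g ∈ galRange K`; `M₁ = eigenSelmerGroupOver V 3 H H' ω`, and
`e₋X = X₁ = Hom(M₁, ℚ₃/ℤ₃)` (`3` odd, `Δ` of order `2`) as a `Λ(Γ)`-module with `T = γ − 1`,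
`γ ∈ Gal(ℚ̄/K)` lifting `χ₃(γ) = 4` (`IsCyclotomicVariable 3 γ`, `κ.IsTopGenerator γ`) — a datum
`D : V.EigenSelmerDualData 3 H H' ω γ`. For `E/ℚ`, `p = 3`: `F_λ = ℚ₃`, `O_λ = ℤ₃`, `T = T₃E(−1)`,
`r = 1`, `Sel(ℚ(ζ_{3^n}), T(1)) = Sel_{3^∞}(E/ℚ(ζ_{3^n}))` (Kato §14.1), so `X(T)` IS `X(E)`.
(12.5.2) / "surjective on the Tate module" is transcribed, as in every tree transcription
(`kato_divisibility` clause 3, p181258, p216633), by "`ρ̄_{E,3^n}` onto for every `n`"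
(`∀ n, HasSurjectiveModNGaloisRep (3^n)`; it implies (12.5.2) since `det ρ = χ₃` cuts out
`ℚ(ζ_{3^∞})`). Periods: `ϖ'·|Ω⁻(E)| = Ω⁻_f` (Pal's imaginary Néron period vs `minusPeriod f`; Kato's
good `ω`/`γ` and Wuthrich's `Ω⁻_E` differ from it by `3`-adic units and powers of `2`), units in
`u ∈ ℤ₃ˣ`; only `ϖ'` enters the odd component.

Hypotheses transcribed: `E = V` globally minimal over `ℚ`; SEMISTABLE at `3` as the disjunction of the
three local types each with ITS odd branch `L⁻` (good ordinary — Kato 17.1 (i): `p ∤ N`,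
`a_p ∈ O_λ^×` — with `L⁻ = padicLFunctionMinusBranch f (unitRoot V 3) 1`; split multiplicative with
`L⁻ = padicLFunctionMinusBranchMult f 1 1`; non-split multiplicative with
`L⁻ = padicLFunctionMinusBranchMult f (−1) 1`); `ρ̄_{E,3^n}` onto for all `n`; `K = ℚ(ζ₃)`
(`IsCyclotomicExtension {3} ℚ K`, `galRange K` normal — automatic, carried as an instance); `κ`
cyclotomic with topological generator `γ ∈ galRange K` matching the cyclotomic variable; `f` the
newform of `E`; `D`; `ϖ'`. Conclusion: `e₋X` is `Λ(Γ)`-torsion (direct summand of the torsion `X`: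
17.4 (1) / §5 p. 397 / Greenberg Thm. 1.5) and `u · ϖ' · L⁻ = ι g` for some `g ∈ char_{Λ(Γ)}(e₋X)`,
`u ∈ ℤ₃ˣ`. Proposed flags: `Kato-17.4-p3-branch-split` / `Wu14-Thm16-p3-branch-split` (the
componentwise reading, one multiplication earlier than p216633 and the surjective multiplicative
siblings) and `Wu14-surj-attribution` (multiplicative clauses). What is NOT here: the even component,
`p ≠ 3`, (12.5.2) in its printed generality, global semistability (Cor. 19's own hypothesis —
replaced, as in p181258, by the surjectivity it is used to produce), any proof. No `_holds` expected.
-- TODO(general form): for every odd `p` over `ℚ(μ_p)` and each `i mod p − 1`: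
-- `char_{Λ(Γ)}(e_i X(E/ℚ(μ_{p^∞}))) ∋ L_p(E, ω^i, T)` under (12.5.2), for lattices in `V_{F_λ}(f)` of
-- any ordinary newform (Kato 17.4 (3)); multiplicative `p` with `ρ_{E,p^∞}` onto (Wuthrich Cor. 19).

Consumer: the BSD rank-≤1 residual cell (`b2b-bsdres`), sub-cell additive-p1, kernel brick 5 (big-image
variant): with `twistDescentEquiv` / `SelmerDualData.toChiEigen` (`AdditivePotMult/TwistDescent.lean`,
`ChiEigenSelmerDual.lean`) and the `T = 0` value of the odd branch this fact makes additive-p4's typed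
input `ChiBranchLeadingTermOddBigImageAt W 3` a theorem for every `W`, hence the rank-`0` upper half
`ord₃ #Ш(E) ≤ ord₃ #Ш_an(E)` for every curve of class X4(M) ∧ surj(3) / X4♯(G-ord) ∧ surj(3)
(ADDITIVE at `3`, potentially semistable-ordinary, `E[3]` irreducible with `ρ̄_{E,3}` onto) from
published theorems + kernel glue. HONEST FRAMING: the cell deletes COMBINATION-SHAPED classes from
published theorems and TYPES the construction-shaped remainder; labels of X3/X4 unchanged by this
file; nothing here is "finishing BSD".
-/

set_option autoImplicit false

noncomputable section

open scoped Classical MatrixGroups ModularForm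

open CongruenceSubgroup WeierstrassCurve Literature.NumberTheory.EllipticCurves
  Literature.NumberTheory.EllipticCurves.ModularForms
  Literature.NumberTheory.GaloisRepresentations

namespace Literature.NumberTheory.EllipticCurves.Wuthrich2014

/-- **Kato's divisibility at `p = 3` under surjective `ρ_{E,3^∞}`, `E` semistable at `3` — the
`ω`-COMPONENT: `char_{Λ(Γ)}(e₋X(E/ℚ(ζ_{3^∞}))) ∋ u · L₃(E, ω, T)`** (Kato, Astérisque 295, Thm. 17.4
(3), p. 273, at a GOOD ORDINARY `3`: "`length_{Λ_𝔭}(X(T)_𝔭) ≤ ord_𝔭(L_{p-adic,α,ω,γ}(f))` for any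
prime ideal `𝔭` of `Λ` of height one" under (12.5.2), `Λ = O_λ⟦Gal(ℚ(ζ_{p^∞})/ℚ)⟧` (§12.1, §17.3),
`X(T)` the dual of `lim_n Sel(ℚ(ζ_{p^n}), T(r))(−r)`, (1): "`X(T)` is a torsion `Λ`-module"; Wuthrich,
Doc. Math. 19 (2014), §1 Thm. 3 with its attribution sentence, p. 383, and Cor. 19 with the first case
of its proof, pp. 398–399, at a MULTIPLICATIVE `3`: "We formulate it here for the full cyclotomic
`ℤ_p^×`-extension. Theorem 3. Let `E` be an elliptic curve and `p` an odd prime of semi-stable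
reduction. […] the characteristic series of the dual of the Selmer group over the cyclotomic extension
[divides the ideal generated by `L_p(E)`] […] This theorem was proven by Kato in the case that the
representation on the Tate module was surjective"; Cor. 19: "`char_Λ X(E)`, or `I char_Λ X(E)` in the
split multiplicative case, divides the ideal generated by `L_p(E)`. Proof. […] in the first case the
representation `ρ_p : G_ℚ → Aut(T_p E)` is surjective […] for `p = 3` we use the following lemma";
§3 p. 390: "we split `M` up into the eigenspaces `M = ⊕ M_i` where `Δ` acts on `M_i` […] by the
`i`-th power of the Teichmüller character"). For `p = 3`: `Λ = Λ(Γ)e₊ ⊕ Λ(Γ)e₋` (`Δ = {1, c}`), the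
height-one primes are those of the two factors, so the printed divisibility says
`char_{Λ(Γ)}(e_±X) ∣ e_±L`; THIS FACT IS ITS `e₋`-HALF `L₃(E, ω, T) ∈ char_{Λ(Γ)}(e₋X)` (split case:
`e₋ ∈ I`, `e₋I = e₋Λ`, no extra factor), `L₃(E, ω, T)` the odd tame branch (Kato Thm. 16.2 with Néron
`ω`, good `γ`; MTT §I.13, minus modular symbols) of the two-term measure with the unit root (good
ordinary) resp. the one-term measure with `α = a₃ = ±1` (multiplicative). Field and module:
`ℚ(ζ_{3^∞}) = K·ℚ_∞`, `K = ℚ(ζ₃)`; `Gal(ℚ̄/ℚ(ζ_{3^∞})) = ker κ ⊓ galRange K` (`κ` the cyclotomic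
`ℤ₃`-extension of `ℚ`), `Δ` acts by `g_*`, `ω(g) = ±1` according as `g ∈ galRange K`;
`M₁ = eigenSelmerGroupOver V 3 (ker κ ⊓ galRange K) (ker κ) ω`, `e₋X = X₁` its Pontryagin dual with
`T = γ − 1`, `γ ∈ Gal(ℚ̄/K)` lifting `χ₃(γ) = 4` — a datum `D : V.EigenSelmerDualData 3 _ _ ω γ` (file
`IwasawaSelmerEigen`). "Surjective on the Tate module" / (12.5.2) spelled `∀ n, Surj(3^n)` (as in
`kato_divisibility` clause 3). Periods: `ϖ'·|Ω⁻(E)| = Ω⁻_f`; units in `u ∈ ℤ₃ˣ`. Hypotheses: `V`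
globally minimal; semistable at `3` as the disjunction (good ordinary, `L⁻ = padicLFunctionMinusBranch
f α 1`, `α = unitRoot V 3`) ∨ (split, `L⁻ = padicLFunctionMinusBranchMult f 1 1`) ∨ (non-split
multiplicative, `L⁻ = padicLFunctionMinusBranchMult f (−1) 1`); `ρ̄_{V,3^n}` onto for all `n`; `K`,
`κ`, `γ`, `f`, `D`, `ϖ'` as displayed. Conclusion:
`Module.IsTorsion Λ D.X ∧ ∃ g ∈ D.charIdeal, ∃ u, ι g = C(u ϖ') · L⁻`. The componentwise reading of
the accepted siblings `Kato2004.charIdeal_dvd_padicLFunction_cyclotomicThree_of_surjective` (p216633,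
flag `Kato-17.4-p3-branch-split`) and
`kato_charIdeal_dvd_[non]splitMultiplicative_cyclotomicThree_of_surjective` (flags
`Wu14-surj-attribution`, `Wu14-Thm16-p3-branch-split`), stopped one multiplication earlier; big-image
twin of `thm16_minusEigenCharIdeal_dvd_cyclotomicThree`. Named fact; nothing asserted.
**RETIRED as a separate named fact (cell `b2b-bsdres`, referee rulings R118.3 / R119.2, 2026-08-20;
deprecate-and-add):** this `p = 3`, `F = K` special case is a KERNEL CONSEQUENCE of the general-`p`
semistable half-eigenspace reading
`Wuthrich2014.kato_halfEigenCharIdeal_dvd_cyclotomicPrime_of_surjective`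
(`SurjectiveDivisibilityCyclotomicPrimeHalf.lean`, p235488) — derivation
`Summit.BirchSwinnertonDyer.Rank1Residual.AdditivePotMult.kato_minusEigenCharIdeal_dvd_cyclotomicThree_of_surjective_of_half`
(`Summits/BirchSwinnertonDyer/Rank1Residual/AdditivePotMult/CyclotomicThreeOfHalf.lean`, p237434).
New consumers take the general fact; existing consumers migrate to the `…_of_half` form when next
touched; this `def` is kept verbatim only until no module references it, then removed.
[cite: Kato2004Asterisque, Thm. 17.4 (1), (3) (p. 273) with §17.3 (p. 273), (12.5.2) (p. 222), §17.5 (p. 274), Thm. 16.2 (p. 269), §12.1 (p. 219)]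
[cite: Wuthrich2014, Thm. 3 and §1 (p. 383), Cor. 19 and its proof (pp. 398–399), §3 (p. 390), §4 (p. 396), §5 (p. 397), Cor. 18 (p. 398)]
[cite: GreenbergLNM1716, Thm. 1.5 (PDF p. 61) and §5 (p. 143)]
[cite: MazurTateTeitelbaum1986Invent, §I.10, §I.13] -/
def kato_minusEigenCharIdeal_dvd_cyclotomicThree_of_surjective : Prop :=
  ∀ (V : WeierstrassCurve ℚ) [V.IsElliptic] [V.IsGloballyMinimal]
    (K : Type) [Field K] [NumberField K] [IsCyclotomicExtension {3} ℚ K]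
    [(galRange (K := ℚ) K).Normal]
    {κ : ZpExtension ℚ 3} {γ : Field.absoluteGaloisGroup ℚ} {N : ℕ} [NeZero N]
    {f : CuspForm (Gamma0 N) 2} (Lminus : PowerSeries ℚ_[3]),
    ((IsOrdinaryAt V 3 ∧
        Lminus = padicLFunctionMinusBranch f ((unitRoot V 3 : ℤ_[3]) : ℚ_[3]) 1) ∨
      (V.HasSplitMultiplicativeReductionAtPrime 3 ∧
        Lminus = padicLFunctionMinusBranchMult f (1 : ℚ_[3]) 1) ∨
      (V.HasMultiplicativeReductionAtPrime 3 ∧ ¬ V.HasSplitMultiplicativeReductionAtPrime 3 ∧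
        Lminus = padicLFunctionMinusBranchMult f (-1 : ℚ_[3]) 1)) →
    (∀ n : ℕ, V.HasSurjectiveModNGaloisRep (3 ^ n : ℕ)) →
    κ.IsCyclotomic → κ.IsTopGenerator γ → IsCyclotomicVariable 3 γ →
    γ ∈ galRange (K := ℚ) K → IsNewformOf V f →
    ∀ (D : V.EigenSelmerDualData 3 (κ.kerSubgroup ⊓ galRange (K := ℚ) K) κ.kerSubgroup
        (fun g ↦ if g ∈ galRange (K := ℚ) K then 1 else -1) γ) (ϖ' : ℚ),
      (ϖ' : ℝ) * V.imaginaryPeriodRat = minusPeriod f →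
      Module.IsTorsion (IwasawaAlgebra 3) D.X ∧
      ∃ g ∈ D.charIdeal, ∃ u : ℤ_[3]ˣ,
        iwasawaToPowerSeries 3 g =
          PowerSeries.C (((u : ℤ_[3]) : ℚ_[3]) * (ϖ' : ℚ_[3])) * Lminus

end Literature.NumberTheory.EllipticCurves.Wuthrich2014

end
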